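import Literature.AlgebraicGeometry.AbelianVarieties.MarkmanDescendedTransformModel
import HarnessLib

/-!
# The pulled-back model: `Φ̃⁺`-image of the input sheaf, twisted, is the class of `q^*E•` for a bounded vector-bundle complex `E•` on `Y`
# (composition of (K5-D) `nonempty_pullback_markmanDescendedTransform_iso`, the (m) MODEL `markmanDescendedTransform_vbModel` and
# `Functor.mapDerivedCategoryPlusFactors` — the three right-most links of the e₂ wiring of record; 0 new facts)

Layer `Literature/AlgebraicGeometry/AbelianVarieties`; sequel to `MarkmanDescendedTransformModel`. CONDITIONAL on the same two named facts
[GS] `Grothendieck_higherDirectImage_coh` and [SP] `ThomasonTrobaugh_vbModel_of_boundedCoh` (hypotheses). No instances. A research route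
conditional on HC_CM, not a corollary — nothing in this file refers to it.

## References

* E. Markman, arXiv:2502.03415 (2025), §9.3 Remark 9.3.7 (p. 73), Lemma 9.3.6 (p. 72). [Markman2025SecantWeil]
* C. Weibel, *An introduction to homological algebra* (1994), 10.5.2 (exact functors on `D⁺`). [Weibel1994]
-/

noncomputable section

-- `TopCat.Presheaf`/`Scheme.Modules` are not reducible (as in Mathlib's `AlgebraicGeometry/Modules/Sheaf.lean`).
set_option backward.isDefEq.respectTransparency false

open CategoryTheory CategoryTheory.Limits AlgebraicGeometry MonoidalCategory CartesianMonoidalCategory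
open AlgebraicGeometry.Scheme.Modules

universe v₁ v₂ v₃ v₄ v₅

namespace Literature.AlgebraicGeometry.AbelianVarieties

open Literature.AlgebraicGeometry.Motives Literature.AlgebraicGeometry.Modules Literature.AlgebraicGeometry.Markman2025
open Literature.AlgebraicGeometry.Morphisms Literature.AlgebraicGeometry.KTheory

variable (A : AbelianVariety ℂ) {Θ : CartierDivisor A.X.left} (hΘ : Θ.IsAmple) (hK : A.KTheta Θ = ⊥)
  {n : ℕ} (hn : n ≠ 0) (G₁ G₂ : Subgroup (A.Points ℂ)) (hG₁ : G₁ ≤ A.torsionPoints ℂ n) (hG₂ : G₂ ≤ A.torsionPoints ℂ n)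

/-- The pulled-back complex `q^*E•` of the model is again a bounded complex of finite locally free modules (on `A × Â`).
[cite: Markman2025SecantWeil, §9.3 Remark 9.3.7 (p. 73)] -/
theorem isBoundedVBComplex_pullback_secantQuotientSchemeMap {K : CochainComplex (secantQuotient A hΘ G₁ G₂ hn hG₁ hG₂).X.left.Modules ℤ}
    (hKvb : IsBoundedVBComplex K) (n₀ : ℤ) (hn₀ : CochainComplex.IsStrictlyGE K n₀) :
    IsBoundedVBComplex ((Scheme.Modules.pullback (secantQuotientSchemeMap A hΘ hn G₁ G₂ hG₁ hG₂)).mapCochainComplexPlus.obj ⟨K, n₀, hn₀⟩).obj :=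
  hKvb.pullback _

variable [HasDerivedCategory.{v₁} (A.X ⊗ A.X).left.Modules]
  [HasDerivedCategory.{v₂} ((A.X ⊗ A.X) ⊗ (A.dualOf Θ hΘ).X).left.Modules]
  [HasDerivedCategory.{v₃} (A.X ⊗ (A.dualOf Θ hΘ).X).left.Modules]
  [HasDerivedCategory.{v₄} ((secantQuotient A hΘ G₁ G₂ hn hG₁ hG₂).X ⊗ A.X).left.Modules]
  [HasDerivedCategory.{v₅} (secantQuotient A hΘ G₁ G₂ hn hG₁ hG₂).X.left.Modules]

/-- **The pulled-back model** — for `F₀` coherent on `A/G₁ × A/G₂` and under [GS]+[SP]: there is a bounded complex `E•` of finite locally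
free `𝒪_Y`-modules, strictly `≥ n₀`, with `(– ⊗ descentTwist)⁺(Φ̃⁺(((π₁ × π₂)^*F₀)[0])) ≅ Q⁺(q^*E•)` in `D⁺(Mod 𝒪_{A × Â})`, `q : A × Â → Y` the
secant quotient isogeny (`q^*E•` = Mathlib's termwise `mapCochainComplexPlus`; it is again a bounded vector-bundle complex by
`IsBoundedVBComplex.pullback`). Proof: (K5-D)⁻¹ ≫ D⁺(q^*)(model iso of `markmanDescendedTransform_vbModel`)⁻¹ ≫ `mapDerivedCategoryPlusFactors`.
[cite: Markman2025SecantWeil, §9.3 Remark 9.3.7 (p. 73)] [cite: Weibel1994, 10.5.2] -/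
theorem markmanKernelTransform_pullback_vbModel (hGS : Grothendieck_higherDirectImage_coh.{0, v₄, v₅})
    (hSP : ThomasonTrobaugh_vbModel_of_boundedCoh.{v₅}) {s j m₁ m₂ : ℕ} (hj : 2 * j + 1 = n)
    (hm₁ : n * m₁ = 2 * s + j + 1) (hm₂ : n * m₂ + j = 2 * s) (hc₁ : Nat.card G₁ = n) (hc₂ : Nat.card G₂ = n)
    (F₀ : ((A.torsionQuot hn G₁ hG₁).X ⊗ (A.torsionQuot hn G₂ hG₂).X).left.Modules) (hF₀ : Coh F₀) :
    ∃ (K : CochainComplex (secantQuotient A hΘ G₁ G₂ hn hG₁ hG₂).X.left.Modules ℤ) (_ : IsBoundedVBComplex K)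
      (n₀ : ℤ) (hn₀ : CochainComplex.IsStrictlyGE K n₀),
      Nonempty
        ((haveI := additive_tensorBifunctor_obj (descentTwist A hΘ hK s j)
          haveI := (isInvertibleModule_of_hasRank_one (isFiniteLocallyFree_descentTwist A hΘ hK s j)
            (hasRank_descentTwist A hΘ hK s j)).preservesFiniteLimits
          haveI := (isInvertibleModule_of_hasRank_one (isFiniteLocallyFree_descentTwist A hΘ hK s j)
            (hasRank_descentTwist A hΘ hK s j)).preservesFiniteColimits
          ((tensorBifunctor (A.X ⊗ (A.dualOf Θ hΘ).X).left).obj (descentTwist A hΘ hK s j)).mapDerivedCategoryPlus).obj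
          ((haveI := preservesFiniteLimits_pullback_pr₁₂ A A (A.dualOf Θ hΘ)
            haveI := (isInvertibleModule_of_hasRank_one (isFiniteLocallyFree_markmanTwistedKernel A hΘ hK)
              (hasRank_markmanTwistedKernel A hΘ hK)).preservesFiniteLimits
            haveI := (isInvertibleModule_of_hasRank_one (isFiniteLocallyFree_markmanTwistedKernel A hΘ hK)
              (hasRank_markmanTwistedKernel A hΘ hK)).preservesFiniteColimits
            integralTransformPlus (pr₁₂ A A (A.dualOf Θ hΘ)).left (kernelSpanMap A hΘ).left (markmanTwistedKernel A hΘ hK)).obj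
            ((DerivedCategory.Plus.singleFunctor _ 0).obj
              ((Scheme.Modules.pullback (quotientPairMap A hn G₁ G₂ hG₁ hG₂)).obj F₀))) ≅
         DerivedCategory.Plus.Q.obj
          ((Scheme.Modules.pullback (secantQuotientSchemeMap A hΘ hn G₁ G₂ hG₁ hG₂)).mapCochainComplexPlus.obj ⟨K, n₀, hn₀⟩)) := by
  haveI : F₀.IsQuasicoherent := isQuasicoherent_of_isAffineLocalizing hF₀.loc
  obtain ⟨K, hKvb, n₀, hn₀, ⟨e⟩⟩ :=
    markmanDescendedTransform_vbModel A hΘ hK hn G₁ G₂ hG₁ hG₂ hGS hSP hj s m₁ m₂ F₀ hF₀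
  obtain ⟨e'⟩ := nonempty_pullback_markmanDescendedTransform_iso A hΘ hK hn G₁ G₂ hG₁ hG₂ hj hm₁ hm₂ hc₁ hc₂ F₀
  haveI : Flat (secantQuotientSchemeMap A hΘ hn G₁ G₂ hG₁ hG₂) :=
    flat_toSchemeHom_of_isIsogeny (isIsogeny_secantQuotientMap A hΘ G₁ G₂ hn hG₁ hG₂)
  haveI := preservesFiniteLimits_pullback_of_flat (secantQuotientSchemeMap A hΘ hn G₁ G₂ hG₁ hG₂)
  exact ⟨K, hKvb, n₀, hn₀, ⟨e'.symm ≪≫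
    (Scheme.Modules.pullback (secantQuotientSchemeMap A hΘ hn G₁ G₂ hG₁ hG₂)).mapDerivedCategoryPlus.mapIso e.symm ≪≫
    (Scheme.Modules.pullback (secantQuotientSchemeMap A hΘ hn G₁ G₂ hG₁ hG₂)).mapDerivedCategoryPlusFactors.app ⟨K, n₀, hn₀⟩⟩⟩

end Literature.AlgebraicGeometry.AbelianVarieties

end
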